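import Summits.ValiantsHypothesis.ValiantsHypothesis.Theorems.BorderApolarityToricFixedPointsToricLimitIsInitialAux1

/-!
# `ToricFixedPoints` / line `form_then_lift`, stub F1 at general `(n,m)`: the `z`-torus of `H₀(n,m)`
forces a common `z`-multidegree on the support

Hypothesis (4) of `stub_formDebordering` (semi-invariance under the group `H₀(n,m)` cut out by the
four matrix conditions) contains, for every position `p` outside the lower-right `n × n` block and
different from `(0,0)` (a "`z`-variable"), the one-parameter torus `diag(1,…,t,…,1)` rescaling `X p`
alone: the four conditions only constrain the block columns, the `(0,0)` column, the block diagonal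
entries and the product `M₀₀^{m-n}·∏ M_{(i,i),(i,i)}`, none of which involve `p`.  Feeding `t = 2` and
comparing coefficients gives `2^{d p}·F = e·F`, hence:

* `h0_zExponent_eq` — any two monomials in the support of such an `F` have the same exponent at every
  `z`-variable.  So `F = z^δ · G(ℓ, Y)` for a single `z`-monomial `z^δ`; the unipotent elements
  `X p ↦ X p + ℓ` of `H₀` then force `δ = 0` (Disproof §6b, paper), and the block torus forces content
  homogeneity of `G` (kernel at `(3,3)`: `FormDeborderingMargins33`).

General `n ≤ m`, verbatim hypothesis text of F1 with `rk` inlined.  Refuter/theory seat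
`val-width-5779-d1` (stmt-ValiantsHypothesis-5779).  VP ≠ VNP is not touched.
-/

open MvPolynomial Finset
open Literature.Computability.AlgebraicComplexity
open Summit.ValiantsHypothesis.ValiantsHypothesis.Theorems.BorderApolarityToricFixedPoints

namespace Summit.ValiantsHypothesis.Cruxes.ToricFixedPoints.Negative

/-- **The `z`-torus of `H₀(n,m)`.**  If `F` satisfies hypothesis (4) of `stub_formDebordering` at
`(n,m)` then for every position `p` with `¬((m-n ≤ p.1 ∧ m-n ≤ p.2) ∨ p = (0,0))` all monomials of the
support of `F` have the same exponent at `p` (feed `M = diag(𝟙 + [· = p])`, i.e. `X p ↦ 2·X p`, and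
compare coefficients). [folklore] -/
theorem h0_zExponent_eq (n m : ℕ) [NeZero m] {F : MvPolynomial (Fin m × Fin m) ℂ}
    (hH : ∀ A : Matrix.GeneralLinearGroup (Fin m × Fin m) ℂ,
      let M : Matrix (Fin m × Fin m) (Fin m × Fin m) ℂ := A
      (∀ i j : Fin m × Fin m, M j i ≠ 0 →
        (fun p : Fin m × Fin m =>
            (if (m - n ≤ (p.1 : ℕ) ∧ m - n ≤ (p.2 : ℕ)) ∨ p = (0, 0) then 0 else m * m) +
              ((p.1 : ℕ) * m + (p.2 : ℕ))) j ≤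
        (fun p : Fin m × Fin m =>
            (if (m - n ≤ (p.1 : ℕ) ∧ m - n ≤ (p.2 : ℕ)) ∨ p = (0, 0) then 0 else m * m) +
              ((p.1 : ℕ) * m + (p.2 : ℕ))) i) →
      (∀ i j : Fin m × Fin m, ((m - n ≤ (i.1 : ℕ) ∧ m - n ≤ (i.2 : ℕ)) ∨ i = (0, 0)) →
        j ≠ i → M j i = 0) →
      (∀ i k j l : Fin m, m - n ≤ (i : ℕ) → m - n ≤ (k : ℕ) → m - n ≤ (j : ℕ) → m - n ≤ (l : ℕ) →
        M (i, j) (i, j) * M (k, l) (k, l) = M (i, l) (i, l) * M (k, j) (k, j)) →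
      M (0, 0) (0, 0) ^ (m - n) * ∏ i ∈ Finset.univ.filter (fun i : Fin m => m - n ≤ (i : ℕ)),
        M (i, i) (i, i) = 1 →
      ∃ e : ℂ, linSubst (Fin m × Fin m) ℂ M F = e • F)
    (p : Fin m × Fin m) (hp : ¬(((m - n ≤ (p.1 : ℕ)) ∧ (m - n ≤ (p.2 : ℕ))) ∨ p = (0, 0)))
    {d d' : (Fin m × Fin m) →₀ ℕ} (hd : d ∈ F.support) (hd' : d' ∈ F.support) : d p = d' p := by
  set v : Fin m × Fin m → ℂ := Function.update (fun _ => (1 : ℂ)) p 2 with hv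
  have hvp : v p = 2 := by simp [hv]
  have hvne : ∀ x, x ≠ p → v x = 1 := fun x hx => by simp [hv, hx]
  have hv0 : ∀ x, v x ≠ 0 := by
    intro x
    by_cases hx : x = p
    · rw [hx, hvp]; exact two_ne_zero
    · rw [hvne x hx]; exact one_ne_zero
  have hdet : (Matrix.diagonal v).det ≠ 0 := by
    rw [Matrix.det_diagonal]; exact Finset.prod_ne_zero_iff.2 fun x _ => hv0 x
  set A : Matrix.GeneralLinearGroup (Fin m × Fin m) ℂ :=
    Matrix.GeneralLinearGroup.mkOfDetNeZero _ hdet with hAdef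
  have hA : (A : Matrix (Fin m × Fin m) (Fin m × Fin m) ℂ) = Matrix.diagonal v := rfl
  -- block positions and `(0,0)` are not `p`, so `v = 1` there
  have hblock : ∀ i j : Fin m, m - n ≤ (i : ℕ) → m - n ≤ (j : ℕ) → v (i, j) = 1 := by
    intro i j hi hj
    refine hvne _ fun h => hp ?_
    rw [← h]
    exact Or.inl ⟨hi, hj⟩
  have h00 : v ((0 : Fin m), (0 : Fin m)) = 1 := by
    refine hvne _ fun h => hp ?_
    rw [← h]
    exact Or.inr rfl
  have c1 : ∀ i j : Fin m × Fin m, (A : Matrix (Fin m × Fin m) (Fin m × Fin m) ℂ) j i ≠ 0 →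
      (fun p : Fin m × Fin m =>
          (if (m - n ≤ (p.1 : ℕ) ∧ m - n ≤ (p.2 : ℕ)) ∨ p = (0, 0) then 0 else m * m) +
            ((p.1 : ℕ) * m + (p.2 : ℕ))) j ≤
      (fun p : Fin m × Fin m =>
          (if (m - n ≤ (p.1 : ℕ) ∧ m - n ≤ (p.2 : ℕ)) ∨ p = (0, 0) then 0 else m * m) +
            ((p.1 : ℕ) * m + (p.2 : ℕ))) i := by
    intro i j h
    rw [hA] at h
    by_cases hji : j = i
    · rw [hji]
    · exact absurd (Matrix.diagonal_apply_ne v hji) h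
  have c2 : ∀ i j : Fin m × Fin m, ((m - n ≤ (i.1 : ℕ) ∧ m - n ≤ (i.2 : ℕ)) ∨ i = (0, 0)) →
      j ≠ i → (A : Matrix (Fin m × Fin m) (Fin m × Fin m) ℂ) j i = 0 := by
    intro i j _ hji
    rw [hA]
    exact Matrix.diagonal_apply_ne v hji
  have c3 : ∀ i k j l : Fin m, m - n ≤ (i : ℕ) → m - n ≤ (k : ℕ) → m - n ≤ (j : ℕ) →
      m - n ≤ (l : ℕ) →
      (A : Matrix (Fin m × Fin m) (Fin m × Fin m) ℂ) (i, j) (i, j) *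
          (A : Matrix (Fin m × Fin m) (Fin m × Fin m) ℂ) (k, l) (k, l) =
        (A : Matrix (Fin m × Fin m) (Fin m × Fin m) ℂ) (i, l) (i, l) *
          (A : Matrix (Fin m × Fin m) (Fin m × Fin m) ℂ) (k, j) (k, j) := by
    intro i k j l hi hk hj hl
    rw [hA]
    simp only [Matrix.diagonal_apply_eq, hblock i j hi hj, hblock k l hk hl, hblock i l hi hl,
      hblock k j hk hj]
  have c4 : (A : Matrix (Fin m × Fin m) (Fin m × Fin m) ℂ) (0, 0) (0, 0) ^ (m - n) *
      ∏ i ∈ Finset.univ.filter (fun i : Fin m => m - n ≤ (i : ℕ)),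
        (A : Matrix (Fin m × Fin m) (Fin m × Fin m) ℂ) (i, i) (i, i) = 1 := by
    rw [hA]
    simp only [Matrix.diagonal_apply_eq, h00, one_pow, one_mul]
    exact Finset.prod_eq_one fun i hi => hblock i i (Finset.mem_filter.1 hi).2 (Finset.mem_filter.1 hi).2
  obtain ⟨e, he⟩ := hH A c1 c2 c3 c4
  rw [hA] at he
  -- the character of `d` under `v` is `2 ^ (d p)`
  have hchar : ∀ δ : (Fin m × Fin m) →₀ ℕ, ∏ x ∈ δ.support, v x ^ δ x = 2 ^ δ p := by
    intro δ
    rw [Finset.prod_subset (Finset.subset_univ δ.support)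
      (fun x _ hx => by rw [Finsupp.notMem_support_iff.1 hx, pow_zero])]
    rw [← Finset.mul_prod_erase _ _ (Finset.mem_univ p), hvp]
    rw [Finset.prod_eq_one fun x hx => by rw [hvne x (Finset.ne_of_mem_erase hx), one_pow], mul_one]
  have key : ∀ {δ : (Fin m × Fin m) →₀ ℕ}, δ ∈ F.support → (2 : ℂ) ^ δ p = e := by
    intro δ hδ
    have h1 := congr_arg (coeff δ) he
    rw [tli_coeff_linSubst_diagonal, coeff_smul, smul_eq_mul, hchar] at h1
    exact mul_right_cancel₀ (mem_support_iff.1 hδ) h1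
  have h2 : (2 : ℂ) ^ d p = (2 : ℂ) ^ d' p := (key hd).trans (key hd').symm
  have h3 : ((2 ^ d p : ℕ) : ℂ) = ((2 ^ d' p : ℕ) : ℂ) := by push_cast; exact h2
  exact Nat.pow_right_injective (le_refl 2) (Nat.cast_inj.1 h3)

end Summit.ValiantsHypothesis.Cruxes.ToricFixedPoints.Negative
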